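import Literature.AnabelianGeometry.SemiGraphs.PSCRamificationProofs
import Literature.AnabelianGeometry.SemiGraphs.ProSigmaCuspInertiaDisjoint
import Literature.AnabelianGeometry.SemiGraphs.ProSigmaCompletionModels
import HarnessLib

/-!
# [CombGC] Rmk. 1.4.3 (2007 text), cuspidal case, AS PRINTED AND TYPED: false at a smooth curve with two cusps (abc-iut FACT-LIST row F-0466)

Mochizuki, *A combinatorial version of the Grothendieck conjecture*, Tohoku Math. J. **59** (2007)
[CombGC] Rmk. 1.4.3 p. 12: for a Galois finite étale `Π_G`-covering `G' → G` of degree a power of `l`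
(`Σ = {l}`), cuspidally totally ramified, and a cusp `e` over which it is connected, "There exists a
finite étale `Π_G`-covering `G'' → G` such that: (a) `G'' → G` is trivial over `G_e`; (b) the subcovering
`G''' → G''` of the composite covering `G''' → G` of the coverings `G'' → G` and `G' → G` is cuspidally
purely totally ramified" (Def. 1.4 (v): totally ramified at ONE cusp of the base and trivial over ALL
OTHER cusps).  Typed verbatim by abc-iut-L3-t4 as `PSCDatum.CuspidalAuxiliaryCoveringExists`, the
cuspidal conjunct of the origin schema `AuxiliaryCoveringsExistHolds Ω` (row F-0466).
[cite: MochizukiCombGC2007, Rmk 1.4.3 p.12]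

FINDING (abc-iut F-L3t4g5-2).  The 2007 claim (b) cannot hold as stated: by (a) every conjugate of
`Π_e` lies in `Π_{G''}`, so `G''` has `deg(G''/G)` cusps over `e` and — by the modular law, `Π_e·Π_{G'} = Π_G`
being total ramification — `G''' → G''` is totally ramified over EACH of them; "purely" then forces
`deg(G''/G) = 1`, i.e. `G'' = G`, and asks `G' → G` itself to be unramified over every cusp `e' ≠ e`
(`smul_cuspGp_le_of_cuspidalAuxiliaryCoveringExists`).  That fails for the `μ_l`-covering of the tripod
ramified at two cusps, and in general: at every datum of SMOOTH-CURVE shape with at least two cusps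
over a profinite pro-`{l}` completion of `Γ_{g,r}` the typed statement is FALSE
(`not_cuspidalAuxiliaryCoveringExists_of_smoothCurve`: the cusp character `c ↦ 1`, `c' ↦ −1` extends
continuously to `Π`, its kernel is a normal open subgroup of index `l` totally ramified at `c` and at
`c'`).  Hence `AuxiliaryCoveringsExistHolds Ω` fails at every origin containing such a datum, e.g. the
genuine tripod over a pro-`l` completion of `F₂` (`exists_genuine_not_auxiliaryCoveringsExistHolds`).

CONTEXT.  This is consistent with the author's own correction: [IUTchI] Rmk. 1.2.3 (i)(ii) (pp. 41–43)
lists "inaccuracies … in [CombGC], Definition 1.4, (v), (vi), and Remarks 1.4.2, 1.4.3, 1.4.4" and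
states that "the cuspidal and nodal cases of the notion of a purely totally ramified covering are in fact
unnecessary and may be deleted", replacing Rmk. 1.4.3 by Rmk. 1.2.3 (iv) (typed separately as
`CuspidalEdgeLikeCharacterization` / `UnrVerticialCharacterization…`).  Row F-0466 (the 2007 text) is
therefore REFUTED AT GENUINE DATA and must not be bound; no tree file consumes it.  PROOF-ONLY file;
nothing here concerns the corrected 2012 statements, and no side is taken on [IUTchIII] Cor. 3.12.
-/

noncomputable section

namespace Literature.AnabelianGeometry.SemiGraphs

namespace PSCDatum

open scoped Pointwise
open Multiplicative
open Literature.GroupTheory.CombinatorialGroupTheory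
open Literature.AnabelianGeometry.Anabelioids (IsSigmaInteger)
open SemiGraphOfAnabelioids (IsProSigmaCompletion)

universe u

variable {P : Type u} [Group P] [TopologicalSpace P] [IsTopologicalGroup P]

/-! ### What the typed 2007 statement forces at prime index -/

omit [IsTopologicalGroup P] in
/-- **Structural consequence of the typed [CombGC] Rmk. 1.4.3 (cuspidal case).**  If
`CuspidalAuxiliaryCoveringExists G` holds, `Σ = {l}`, and `H' ⊴ Π` is a normal open subgroup of index `l`
over which the cusp `(c, γ)` is totally ramified (`γΠ_cγ⁻¹ · H' = Π`), then EVERY conjugate of EVERY OTHER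
cusp group lies in `H'` (the covering is unramified at all other cusps): the auxiliary `G''` must be `G`
itself, because the pulled-back covering is totally ramified over each of the `[Π : Π_{G''}]` cusps of
`G''` above `c`. [cite: MochizukiCombGC2007, Rmk 1.4.3 p.12] -/
theorem smul_cuspGp_le_of_cuspidalAuxiliaryCoveringExists (G : PSCDatum P)
    (h : G.CuspidalAuxiliaryCoveringExists) {l : ℕ} (hSig : G.Sigma = {l}) {H' : Subgroup P}
    [hN : H'.Normal] (hO : IsOpen (H' : Set P)) (hidx : H'.index = l) {c : G.graph.C}
    {γ : ConjAct P} (htot : γ • G.cuspGp c ⊔ H' = ⊤) {c' : G.graph.C} (hc : c' ≠ c)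
    (δ : ConjAct P) : δ • G.cuspGp c' ≤ H' := by
  have hl : l.Prime := G.prime_of_sigma_eq hSig
  have hH'ne : H' ≠ ⊤ := fun hT => by
    rw [hT, Subgroup.index_top] at hidx
    exact hl.one_lt.ne' hidx.symm
  -- every conjugate of `Π_c` is totally ramified, hence none lies in `H'`
  have hkey : ∀ x : ConjAct P, ¬ x • G.cuspGp c ≤ H' := fun x hx => hH'ne (by
    have hx' : x • G.cuspGp c ⊔ H' = ⊤ :=
      (smul_sup_eq_top_iff x (G.cuspGp c) H').mpr ((smul_sup_eq_top_iff γ _ H').mp htot)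
    rwa [sup_eq_right.mpr hx] at hx')
  obtain ⟨H'', -, hnc, -, c₁, γ₁, -, hpure⟩ :=
    h l 1 H' c γ hSig hN hO (by rw [hidx, pow_one]) htot
  -- all conjugates of `Π_c` lie in `H''`
  have hconj : ∀ x : ConjAct P, x • G.cuspGp c ≤ H'' := by
    intro x y hy
    obtain ⟨z, hz, rfl⟩ := (Subgroup.mem_smul_pointwise_iff_exists _ _ _).mp hy
    have hz' : γ • z ∈ Subgroup.normalClosure (((γ • G.cuspGp c : Subgroup P)) : Set P) :=
      Subgroup.subset_normalClosure (Subgroup.smul_mem_pointwise_smul _ _ _ hz)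
    have := (Subgroup.normalClosure_normal (s := ((γ • G.cuspGp c : Subgroup P) : Set P))).conj_mem
      _ hz' (ConjAct.ofConjAct (x * γ⁻¹))
    refine hnc ?_
    convert this using 1
    rw [ConjAct.smul_def, ConjAct.smul_def, ConjAct.ofConjAct_mul, ConjAct.ofConjAct_inv]
    group
  -- Step 1: the ramified cusp of `G''` lies over `c`
  have hc₁ : c₁ = c := by
    by_contra hne
    have hle := hpure c γ (Or.inl (Ne.symm hne))
    exact hkey γ (fun y hy => (hle ⟨hconj γ hy, hy⟩).2)
  subst hc₁
  -- Step 2: `H'' = Π`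
  have hH'' : H'' = ⊤ := by
    by_contra hne
    obtain ⟨x₀, hx₀⟩ : ∃ x₀ : P, x₀ ∉ H'' :=
      not_forall.mp fun hall => hne (top_le_iff.mp fun x _ => hall x)
    set x : P := x₀ * ConjAct.ofConjAct γ₁ with hxdef
    have hx : x ∉ DoubleCoset.doubleCoset (ConjAct.ofConjAct γ₁) (H'' : Set P) (G.cuspGp c₁ : Set P) := by
      intro hmem
      obtain ⟨a, ha, p, hp, hap⟩ := DoubleCoset.mem_doubleCoset.mp hmem
      apply hx₀
      have hx₀eq : x₀ = a * (γ₁ • p) := by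
        rw [ConjAct.smul_def]
        have : x₀ = x * (ConjAct.ofConjAct γ₁)⁻¹ := by rw [hxdef, mul_inv_cancel_right]
        rw [this, hap]; group
      rw [hx₀eq]
      exact H''.mul_mem ha (hconj γ₁ (Subgroup.smul_mem_pointwise_smul _ _ _ hp))
    have hle := hpure c₁ (ConjAct.toConjAct x) (Or.inr (by rwa [ConjAct.ofConjAct_toConjAct]))
    exact hkey (ConjAct.toConjAct x) (fun y hy => (hle ⟨hconj _ hy, hy⟩).2)
  -- Step 3: purity at the other cusp
  subst hH''
  have hle := hpure c' δ (Or.inl hc)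
  intro y hy
  exact (hle ⟨Subgroup.mem_top y, hy⟩).2

/-! ### Failure at smooth curves with two cusps -/

section SmoothCurve

variable [CompactSpace P] [T2Space P] [TotallyDisconnectedSpace P]

omit [T2Space P] in
/-- **The typed [CombGC] Rmk. 1.4.3 (cuspidal case) FAILS at every smooth-curve datum with two distinct
cusps over a profinite pro-`{l}` completion** (`Σ = {l}`; any type `(g, r)`, hyperbolicity is not
even needed): the cusp character `c ↦ 1`, `c' ↦ −1` of
`Γ_{g,r}` extends continuously to `Π`; its kernel is a normal open subgroup of index `l` at which `c` is
totally ramified, yet `Π_{c'}` is not contained in it. [cite: MochizukiCombGC2007, Rmk 1.4.3 p.12] -/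
theorem not_cuspidalAuxiliaryCoveringExists_of_smoothCurve {l g r : ℕ} (hl : l.Prime)
    (ι : PuncturedSurfaceGroup g r →* P)
    (hι : IsProSigmaCompletion {l} ι) (G : PSCDatum P) (hSig : G.Sigma = {l}) (e : G.graph.C ≃ Fin r)
    (hC : ∀ c, G.cuspGp c =
      ((PuncturedSurfaceGroup.cuspInertia (g := g) (e c)).map ι).topologicalClosure)
    {c c' : G.graph.C} (hcc : c' ≠ c) : ¬ G.CuspidalAuxiliaryCoveringExists := by
  classical
  intro hAux
  haveI : Fact (1 < l) := ⟨hl.one_lt⟩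
  -- the cusp character `c ↦ 1`, `c' ↦ -1`
  let w : Fin r → ZMod l := fun k => (if k = e c then 1 else 0) + (if k = e c' then -1 else 0)
  have hee : e c' ≠ e c := fun h' => hcc (e.injective h')
  have hw : ∑ k, w k = 0 := by
    simp only [w, Finset.sum_add_distrib, Finset.sum_ite_eq', Finset.mem_univ, if_true]
    exact add_neg_cancel 1
  obtain ⟨φ, hφ⟩ := PuncturedSurfaceGroup.exists_cuspCharacter (g := g) w hw
  have hφc : φ (PuncturedSurfaceGroup.c (e c)) = ofAdd 1 := by
    rw [hφ]; simp [w, Ne.symm hee]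
  have hφc' : φ (PuncturedSurfaceGroup.c (e c')) = ofAdd (-1) := by
    rw [hφ]; simp [w, hee]
  have hcard : IsSigmaInteger {l} (Nat.card (Multiplicative (ZMod l))) := by
    rw [show Nat.card (Multiplicative (ZMod l)) = l from Nat.card_zmod l]
    exact ⟨hl.pos, fun p hp hpl => (Nat.prime_dvd_prime_iff_eq hp hl).mp hpl⟩
  obtain ⟨χ, hχc, hχ⟩ := hι.exists_continuous_extend_top hcard φ
  -- `H' := Ker χ`: normal, open, of index `l`, totally ramified at `c`
  have hO : IsOpen (χ.ker : Set P) := (isOpen_discrete ({1} : Set _)).preimage hχc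
  have hιc : ι (PuncturedSurfaceGroup.c (e c)) ∈ G.cuspGp c := by
    rw [hC, PuncturedSurfaceGroup.cuspInertia, MonoidHom.map_zpowers]
    exact Subgroup.le_topologicalClosure _ (Subgroup.mem_zpowers _)
  have hιc' : ι (PuncturedSurfaceGroup.c (e c')) ∈ G.cuspGp c' := by
    rw [hC, PuncturedSurfaceGroup.cuspInertia, MonoidHom.map_zpowers]
    exact Subgroup.le_topologicalClosure _ (Subgroup.mem_zpowers _)
  have hpow : ∀ m : ZMod l, χ (ι (PuncturedSurfaceGroup.c (e c)) ^ m.val) = ofAdd m := by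
    intro m
    rw [map_pow, hχ, hφc, ← ofAdd_nsmul, nsmul_eq_mul, mul_one, ZMod.natCast_zmod_val]
  have hsurj : Function.Surjective χ := fun m => ⟨_, hpow (toAdd m)⟩
  have hidx : χ.ker.index = l := by
    rw [Subgroup.index_ker, MonoidHom.range_eq_top.mpr hsurj, Subgroup.card_top]
    exact Nat.card_zmod l
  have htot : (1 : ConjAct P) • G.cuspGp c ⊔ χ.ker = ⊤ := by
    rw [one_smul]
    refine top_le_iff.mp fun x _ => ?_
    set m : ZMod l := toAdd (χ x) with hm
    have hker : x * (ι (PuncturedSurfaceGroup.c (e c)) ^ m.val)⁻¹ ∈ χ.ker := by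
      rw [MonoidHom.mem_ker, map_mul, map_inv, hpow, hm, ofAdd_toAdd, mul_inv_cancel]
    have := (G.cuspGp c ⊔ χ.ker).mul_mem (Subgroup.mem_sup_right hker)
      (Subgroup.mem_sup_left (Subgroup.pow_mem _ hιc m.val))
    rwa [inv_mul_cancel_right] at this
  -- the structural consequence puts `Π_{c'}` inside `Ker χ` — but `χ(ι c') = -1 ≠ 0`
  have hle := G.smul_cuspGp_le_of_cuspidalAuxiliaryCoveringExists hAux hSig hO hidx htot hcc 1
  rw [one_smul] at hle
  have h1 : χ (ι (PuncturedSurfaceGroup.c (e c'))) = 1 := hle hιc'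
  rw [hχ, hφc'] at h1
  have : (-1 : ZMod l) = 0 := ofAdd_eq_one.mp h1
  exact one_ne_zero (neg_eq_zero.mp this)

end SmoothCurve

/-! ### A genuine counter-datum: the tripod over a pro-`l` completion of `F₂` -/

/-- **Row F-0466 is refuted at genuine data.**  For every prime `l` there is a profinite pro-`{l}`
completion `Π` of `Γ_{0,3} = π₁(P¹ ∖ {0,1,∞})` (free of rank 2) and the smooth-curve datum of the TRIPOD
over it (`Σ = {l}`, one vertex `Π_v = Π` of genus `0`, three cusps with `Π_{c_i} = closure ι⟨c_i⟩`) at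
which the typed [CombGC] Rmk. 1.4.3 (cuspidal case) FAILS; consequently `AuxiliaryCoveringsExistHolds Ω`
fails at every origin `Ω` declaring this datum "of PSC-type" — as the intended geometric origin of
Def. 1.1 (i) does (char `≠ l`).  Consistent with the author's correction [IUTchI] Rmk. 1.2.3 (ii).
[cite: MochizukiCombGC2007, Rmk 1.4.3 p.12] -/
theorem exists_genuine_not_auxiliaryCoveringsExistHolds {l : ℕ} (hl : l.Prime) :
    ∃ (Pc : ProfiniteGrp.{0}) (ι : PuncturedSurfaceGroup 0 3 →* Pc) (G : PSCDatum Pc),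
      IsProSigmaCompletion {l} ι ∧ G.Sigma = {l} ∧ G.graph.i = 1 ∧ G.graph.n = 0 ∧ G.graph.r = 3 ∧
      (∀ v, G.vertGp v = ⊤ ∧ G.genus v = 0) ∧
      (∀ c, ∃ i : Fin 3, G.cuspGp c =
        ((PuncturedSurfaceGroup.cuspInertia (g := 0) i).map ι).topologicalClosure) ∧
      ¬ G.CuspidalAuxiliaryCoveringExists ∧
      ∀ Ω : PSCOrigin.{0}, Ω.IsOfPSCType G → ¬ AuxiliaryCoveringsExistHolds Ω := by
  obtain ⟨Pc, ι, hι⟩ :=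
    SemiGraphOfAnabelioids.IsProSigmaCompletion.exists_isProSigmaCompletion
      (PuncturedSurfaceGroup 0 3) {l}
  let G : PSCDatum Pc :=
    { Sigma := {l}
      sigma_prime := fun p hp => by rw [Set.mem_singleton_iff.mp hp]; exact hl
      sigma_nonempty := ⟨l, rfl⟩
      graph := { V := Unit, N := Empty, C := Fin 3, nodeEnds := Empty.elim, cuspEnd := fun _ => () }
      vertGp := fun _ => ⊤
      nodeGp := Empty.elim
      cuspGp := fun i => ((PuncturedSurfaceGroup.cuspInertia (g := 0) i).map ι).topologicalClosure
      genus := fun _ => 0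
      isClosed_vertGp := fun _ => by rw [Subgroup.coe_top]; exact isClosed_univ
      isClosed_nodeGp := fun e => e.elim
      isClosed_cuspGp := fun _ => Subgroup.isClosed_topologicalClosure _
      nodeGp_le := fun e => e.elim
      cuspGp_le := fun _ => ⟨1, le_top⟩
      proSigma := ⟨fun U _ p hp hdvd => (hι.index_open _ U.isNormal' U.isOpen').2 p hp hdvd⟩ }
  have hnot : ¬ G.CuspidalAuxiliaryCoveringExists :=
    G.not_cuspidalAuxiliaryCoveringExists_of_smoothCurve hl ι hι rfl (Equiv.refl _)
      (fun _ => rfl) (c := (0 : Fin 3)) (c' := (1 : Fin 3)) (show (1 : Fin 3) ≠ 0 by decide)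
  exact ⟨Pc, ι, G, hι, rfl, rfl, rfl, rfl, fun _ => ⟨rfl, rfl⟩, fun c => ⟨c, rfl⟩, hnot,
    fun Ω hG hH => hnot (hH G hG).1⟩

/-! ### The verticial conjunct of the 2007 remark: the same mechanism -/

/-- **Structural consequence of the typed [CombGC] Rmk. 1.4.3, VERTICIAL case** (third conjunct of
F-0466; `Π^unr_G`-coverings, `G` sturdy): if `VerticialAuxiliaryCoveringExists G` holds, `Σ = {l}`, and
`H' ⊴ Π` is a normal open `Π^unr_G`-covering of index `l` over which the vertex `(v, γ)` is totally
ramified (`γΠ_vγ⁻¹ · H' = Π`), then EVERY conjugate of EVERY OTHER verticial group lies in `H'` — the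
auxiliary `G''` is forced to be `G` exactly as in the cuspidal case
(`smul_cuspGp_le_of_cuspidalAuxiliaryCoveringExists`).  Hence the verticial conjunct fails at any genuine
datum with two vertices admitting an `l`-cyclic `Π^unr`-covering connected over both (two components
each with a connected étale `ℤ/l`-cover); the tree has no genuine multi-vertex PSC datum yet, so only the
mechanism is certified here. [cite: MochizukiCombGC2007, Rmk 1.4.3 p.12] -/
theorem smul_vertGp_le_of_verticialAuxiliaryCoveringExists (G : PSCDatum P)
    (h : G.VerticialAuxiliaryCoveringExists) (hst : G.IsSturdy) {l : ℕ} (hSig : G.Sigma = {l})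
    {H' : Subgroup P} [hN : H'.Normal] (hO : IsOpen (H' : Set P)) (hidx : H'.index = l)
    (hunr : G.IsUnrCovering H') {v : G.graph.V} {γ : ConjAct P} (htot : γ • G.vertGp v ⊔ H' = ⊤)
    {v' : G.graph.V} (hv : v' ≠ v) (δ : ConjAct P) : δ • G.vertGp v' ≤ H' := by
  have hl : l.Prime := G.prime_of_sigma_eq hSig
  have hH'ne : H' ≠ ⊤ := fun hT => by
    rw [hT, Subgroup.index_top] at hidx
    exact hl.one_lt.ne' hidx.symm
  have hkey : ∀ x : ConjAct P, ¬ x • G.vertGp v ≤ H' := fun x hx => hH'ne (by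
    have hx' : x • G.vertGp v ⊔ H' = ⊤ :=
      (smul_sup_eq_top_iff x (G.vertGp v) H').mpr ((smul_sup_eq_top_iff γ _ H').mp htot)
    rwa [sup_eq_right.mpr hx] at hx')
  obtain ⟨H'', -, -, hnc, -, v₁, γ₁, -, hpure⟩ :=
    h hst l 1 H' v γ hSig hN hO (by rw [hidx, pow_one]) hunr htot
  have hconj : ∀ x : ConjAct P, x • G.vertGp v ≤ H'' := by
    intro x y hy
    obtain ⟨z, hz, rfl⟩ := (Subgroup.mem_smul_pointwise_iff_exists _ _ _).mp hy
    have hz' : γ • z ∈ Subgroup.normalClosure (((γ • G.vertGp v : Subgroup P)) : Set P) :=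
      Subgroup.subset_normalClosure (Subgroup.smul_mem_pointwise_smul _ _ _ hz)
    have := (Subgroup.normalClosure_normal (s := ((γ • G.vertGp v : Subgroup P) : Set P))).conj_mem
      _ hz' (ConjAct.ofConjAct (x * γ⁻¹))
    refine hnc ?_
    convert this using 1
    rw [ConjAct.smul_def, ConjAct.smul_def, ConjAct.ofConjAct_mul, ConjAct.ofConjAct_inv]
    group
  have hv₁ : v₁ = v := by
    by_contra hne
    have hle := hpure v γ (Or.inl (Ne.symm hne))
    exact hkey γ (fun y hy => (hle ⟨hconj γ hy, hy⟩).2)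
  subst hv₁
  have hH'' : H'' = ⊤ := by
    by_contra hne
    obtain ⟨x₀, hx₀⟩ : ∃ x₀ : P, x₀ ∉ H'' :=
      not_forall.mp fun hall => hne (top_le_iff.mp fun x _ => hall x)
    set x : P := x₀ * ConjAct.ofConjAct γ₁ with hxdef
    have hx : x ∉ DoubleCoset.doubleCoset (ConjAct.ofConjAct γ₁) (H'' : Set P) (G.vertGp v₁ : Set P) := by
      intro hmem
      obtain ⟨a, ha, p, hp, hap⟩ := DoubleCoset.mem_doubleCoset.mp hmem
      apply hx₀
      have hx₀eq : x₀ = a * (γ₁ • p) := by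
        rw [ConjAct.smul_def]
        have : x₀ = x * (ConjAct.ofConjAct γ₁)⁻¹ := by rw [hxdef, mul_inv_cancel_right]
        rw [this, hap]; group
      rw [hx₀eq]
      exact H''.mul_mem ha (hconj γ₁ (Subgroup.smul_mem_pointwise_smul _ _ _ hp))
    have hle := hpure v₁ (ConjAct.toConjAct x) (Or.inr (by rwa [ConjAct.ofConjAct_toConjAct]))
    exact hkey (ConjAct.toConjAct x) (fun y hy => (hle ⟨hconj _ hy, hy⟩).2)
  subst hH''
  have hle := hpure v' δ (Or.inl hv)
  intro y hy
  exact (hle ⟨Subgroup.mem_top y, hy⟩).2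

end PSCDatum

end Literature.AnabelianGeometry.SemiGraphs

end
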